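import Mathlib
import HarnessLib.Audit
import Summits.PneNP.PneNP.Theorems.PstarGateCaseTLocal

/-!
# One GATED chord: the fibre dichotomy from chamber SEPARATION alone, and the doubly-read (U2) companion chord (E2 branches B1/U2; prover-1 g18)

FRONTIER range-avoidance ladder, rung F-N3 (`stmt-PneNP-19007`), cell `pnp-ideate` (this seat's `HOME/pnp-ideate-prover-1/g18/E2-PLAN.md` §2 B1/B3);
restricted-model proof complexity — nothing here bears on `P` versus `NP`.

`PstarGateCaseTLocal.caseT_fibre_dichotomy` uses CASE T only through the SEPARATION `{x_u = c} ∩ Z(u_e) ∩ Z(u_{e'}) = ∅` on the gate chamber.  This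
file isolates that: `fibre_dichotomy_of_sep` — separation on the hyperplane `{x_u = c}` + rank `≥ 4` of `Q_{D e}`, `Q_{D e'}` on `coordKer {u}` ⟹
(`c = 0` ∧ every edge of `D e ∆ D e'` passes through `u`) ∨ (EXC on the chamber).  Separation holds whenever the other chord carries, at every point of the
chamber where the gate reads, SOME non-zero read vector different from the gate's `(1,0)` (`sep_of_transverse_read`, from
`PstarGateDirection.parallel_of_cokillable`) — in particular for a DOUBLY-READ chord `e'` (two independent constant reads: the (U2) corner of the
two-chord branch `N = {e, e'}`), `sep_of_U2`.  So the triangle/square structure of `PstarGateCaseTCycle` / `PstarGateCaseTChords` also governs the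
(U2) branch.
-/

set_option linter.dupNamespace false -- `Summit.PneNP.PneNP.…`: summit = sub-problem name (D-0017 single-conjunct layout)

open Finset Module Literature.Computability.Complexity
open scoped symmDiff
open Summit.PneNP.PneNP.Theorems.PstarTyped (Typed)
open Summit.PneNP.PneNP.Theorems.PstarSALevel (varSet bdry BoundaryExpanding SimpleOverlap)
open Summit.PneNP.PneNP.Theorems.PstarCubeIdeals (IsAffineFn isAffineFn_of_linear)
open Summit.PneNP.PneNP.Theorems.PstarProductRank (qform polar)
open Summit.PneNP.PneNP.Theorems.PstarQuadRank (rad)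
open Summit.PneNP.PneNP.Theorems.PstarForcing (exists_ne_of_rank_four not_rank_four_of_mul)
open Summit.PneNP.PneNP.Theorems.PstarQuadRestrict (quad_restrict)
open Summit.PneNP.PneNP.Theorems.PstarPathRankFibre (coordKer mem_coordKer forcing_cases_fibre)
open Summit.PneNP.PneNP.Theorems.PstarReadSumset (V2)
open Summit.PneNP.PneNP.Theorems.PstarChordSystem (ChordSystem)
open Summit.PneNP.PneNP.Theorems.PstarChordBridgeTools (privs coef)
open Summit.PneNP.PneNP.Theorems.PstarChordBridge (BridgeData sys Solution Lift infeasible_of_not_solution)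
open Summit.PneNP.PneNP.Theorems.PstarChordBridgeForcing (gam sys_u_eq qform_add')
open Summit.PneNP.PneNP.Theorems.PstarChordBridgeFundamental (eq_of_fundamental_eq)
open Summit.PneNP.PneNP.Theorems.PstarChordBridgeKill (qform_symmDiff)
open Summit.PneNP.PneNP.Theorems.PstarGateDirection (parallel_of_cokillable)
open Summit.PneNP.PneNP.Theorems.PstarGateBridge (GateHyp gate_reads)
open Summit.PneNP.PneNP.Theorems.PstarGateHyperplane (const_on_hyperplane)
open Summit.PneNP.PneNP.Theorems.PstarGateCaseTLocal (u_add)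

namespace Summit.PneNP.PneNP.Theorems.PstarGateFibre

variable {n m : ℕ}

/-- Every element of `𝔽₂` is `0` or `1`. -/
private theorem zmod2_cases (t : ZMod 2) : t = 0 ∨ t = 1 := by
  revert t; decide

/-- **Separation from a transverse read.**  At a point where the gated chord `e` reads (`coef = 1`) and another chord `e'` carries a non-zero read
vector different from `(1,0)`, the two are not both killable. -/
theorem sep_of_transverse_read (I : LocalMap 4 n m) (hI : I.IsPure xorAndPred) (hT : Typed I) {B : BridgeData n m} (hW : B.WF I) (hL : Lift I B)
    {e : Fin m} (hG : GateHyp I B e) (hT3 : ¬ ∃ z, Solution I B B.J₀ z) {e' : Fin m} (he' : e' ∈ B.N) (hne : e' ≠ e) {x : Fin n → ZMod 2}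
    {y : V2} (hy : y = (sys I B).ρ e' x ∨ y = (sys I B).ρ' e' x) (hy0 : y ≠ 0) (hy1 : y ≠ (1, 0))
    (hl : coef I B.C₁ B.G₁ (I.vars e 2) x = 1) (hue : (sys I B).u e x = 0) : (sys I B).u e' x ≠ 0 := by
  intro hue'
  have hinf : (sys I B).Infeasible B.N := infeasible_of_not_solution I hI hT hW hL hT3
  have hρ : (sys I B).ρ e x = (1, 0) := by rw [(gate_reads I hI hG x).1, hl]
  exact hy1 (parallel_of_cokillable (sys I B) hinf hG.1 he' (Ne.symm hne) hρ (by decide) hy hy0 hue hue')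

/-- **Separation for a doubly-read chord** (constant independent reads: one of them is not the gate's direction). -/
theorem sep_of_U2 (I : LocalMap 4 n m) (hI : I.IsPure xorAndPred) (hT : Typed I) {B : BridgeData n m} (hW : B.WF I) (hL : Lift I B)
    {e : Fin m} (hG : GateHyp I B e) (hT3 : ¬ ∃ z, Solution I B B.J₀ z) {e' : Fin m} (he' : e' ∈ B.N) (hne : e' ≠ e) {x : Fin n → ZMod 2}
    (h1 : (sys I B).ρ e' x ≠ 0) (h2 : (sys I B).ρ' e' x ≠ 0) (h12 : (sys I B).ρ e' x ≠ (sys I B).ρ' e' x)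
    (hl : coef I B.C₁ B.G₁ (I.vars e 2) x = 1) (hue : (sys I B).u e x = 0) : (sys I B).u e' x ≠ 0 := by
  by_cases hρ1 : (sys I B).ρ e' x = (1, 0)
  · exact sep_of_transverse_read I hI hT hW hL hG hT3 he' hne (Or.inr rfl) h2 (fun h => h12 (hρ1.trans h.symm)) hl hue
  · exact sep_of_transverse_read I hI hT hW hL hG hT3 he' hne (Or.inl rfl) h1 hρ1 hl hue

/-- **The fibre dichotomy from separation.**  Well-formed bridge data on a pure instance with simple overlaps, chords `e ≠ e'`, a variable `u` and a
chamber value `c` with SEPARATION `{x_u = c} ∩ Z(u_e) ∩ Z(u_{e'}) = ∅`, rank `≥ 4` of `Q_{D e}`, `Q_{D e'}` on `coordKer {u}`.  Then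
(`c = 0` ∧ every edge of `D e ∆ D e'` passes through `u`) ∨ (EXC on the chamber `{x_u = c}`). -/
theorem fibre_dichotomy_of_sep (I : LocalMap 4 n m) (hI : I.IsPure xorAndPred) (hS : SimpleOverlap I) {B : BridgeData n m}
    (hW : B.WF I) {e : Fin m} (he : e ∈ B.N) {e' : Fin m} (he' : e' ∈ B.N) (hne : e' ≠ e) {u : Fin n} {c : ZMod 2}
    (hsep : ∀ x : Fin n → ZMod 2, x u = c → (sys I B).u e x = 0 → (sys I B).u e' x ≠ 0)
    (hrD : finrank (ZMod 2) (rad ((polar (B.D e) (fun j => I.vars j 2) (fun j => I.vars j 3)).restrict (coordKer ({u} : Finset (Fin n))))) + 4 ≤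
      finrank (ZMod 2) (coordKer ({u} : Finset (Fin n))))
    (hrD' : finrank (ZMod 2) (rad ((polar (B.D e') (fun j => I.vars j 2) (fun j => I.vars j 3)).restrict (coordKer ({u} : Finset (Fin n))))) + 4 ≤
      finrank (ZMod 2) (coordKer ({u} : Finset (Fin n)))) :
    (c = 0 ∧ ∀ j ∈ B.D e ∆ B.D e', I.vars j 2 = u ∨ I.vars j 3 = u) ∨
    (∃ ν₁ ν₂ : coordKer ({u} : Finset (Fin n)) → ZMod 2, IsAffineFn ν₁ ∧ IsAffineFn ν₂ ∧ ∃ κ : ZMod 2,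
      ∀ w : coordKer ({u} : Finset (Fin n)),
        qform (B.D e ∆ B.D e') (fun j => I.vars j 2) (fun j => I.vars j 3) ((Pi.single u c : Fin n → ZMod 2) + (w : Fin n → ZMod 2)) =
          ν₁ w * ν₂ w + κ) := by
  classical
  set W : Submodule (ZMod 2) (Fin n → ZMod 2) := coordKer ({u} : Finset (Fin n)) with hWdef
  set x₀ : Fin n → ZMod 2 := Pi.single u c with hx₀
  set q : (Fin n → ZMod 2) → ZMod 2 := fun x => (sys I B).u e x with hq
  set Q : (Fin n → ZMod 2) → ZMod 2 := fun x => qform (B.D e') (fun j => I.vars j 2) (fun j => I.vars j 3) x with hQ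
  have hx₀u : x₀ u = c := by rw [hx₀, Pi.single_eq_same]
  -- the separation on the chamber: `u_e = 0 ⟹ Q_{D e'} = γ' + 1`
  have hZ : ∀ w : W, q (x₀ + w) = 0 → Q (x₀ + w) = gam B e' + 1 := by
    intro w hw
    have hwu : (w : Fin n → ZMod 2) u = 0 := (mem_coordKer.1 w.2) u (mem_singleton_self u)
    have hxu : (x₀ + (w : Fin n → ZMod 2)) u = c := by rw [Pi.add_apply, hx₀u, hwu, add_zero]
    have hne0 := hsep _ hxu hw
    have hu1 : (sys I B).u e' (x₀ + w) = 1 := (zmod2_cases _).resolve_left hne0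
    rw [sys_u_eq] at hu1
    have e1 : ∀ g Q : ZMod 2, g + Q = 1 → Q = g + 1 := by decide
    exact e1 _ _ hu1
  have hBq : ∀ x w, q (x + w) = q x + q w + q 0 + polar (B.D e) (fun j => I.vars j 2) (fun j => I.vars j 3) x w :=
    fun x w => u_add I B e x w
  have hBQ : ∀ x w, Q (x + w) = Q x + Q w + Q 0 + polar (B.D e') (fun j => I.vars j 2) (fun j => I.vars j 3) x w :=
    fun x w => qform_add' I (B.D e') x w
  rcases forcing_cases_fibre hBq hBQ W x₀ hrD' hZ with h1 | ⟨κ, h2⟩ | ⟨ν₁, ν₂, hν₁, hν₂, κ, h3⟩ | ⟨a, b, -, hnor, -⟩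
  · -- `u_e ≡ 1` on the chamber: contradicts rank four of `Q_{D e}` there
    exfalso
    obtain ⟨v, hv⟩ := exists_ne_of_rank_four (M := W) (Q := fun w : W => q (x₀ + w)) (quad_restrict hBq W x₀) hrD
    refine hv ?_
    show q (x₀ + ↑v) = q (x₀ + ↑(0 : W))
    rw [h1 v, h1 0]
  · -- (EQ): `Q_{D e ∆ D e'}` is constant on the chamber
    left
    have hconst : ∀ x : Fin n → ZMod 2, x u = c →
        qform (B.D e ∆ B.D e') (fun j => I.vars j 2) (fun j => I.vars j 3) x = gam B e + κ := by
      intro x hxu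
      have hw : x - x₀ ∈ W := by
        refine mem_coordKer.2 fun w hw => ?_
        rw [mem_singleton.1 hw, Pi.sub_apply, hxu, hx₀u, sub_self]
      have h := h2 ⟨x - x₀, hw⟩
      simp only [hQ, hq] at h
      have hxx : x₀ + (x - x₀) = x := add_sub_cancel x₀ x
      rw [hxx, sys_u_eq] at h
      rw [qform_symmDiff, h]
      have e3 : ∀ g a k : ZMod 2, a + (g + a + k) = g + k := by decide
      exact e3 _ _ _
    obtain ⟨hthrough, hempty⟩ := const_on_hyperplane I hI hS (B.D e ∆ B.D e') u c (gam B e + κ) hconst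
    refine ⟨?_, hthrough⟩
    rcases zmod2_cases c with h0 | h1
    · exact h0
    · -- `c = 1`: `D e = D e'` and `e = e'`
      exfalso
      have hDD : B.D e = B.D e' := Finset.symmDiff_eq_empty.1 (hempty h1)
      have heD : e ∉ B.D e := fun h => (mem_sdiff.1 (hW.hD e he h)).2 he
      have he'D : e' ∉ B.D e := fun h => (mem_sdiff.1 (hW.hD e he h)).2 he'
      have hev := hW.hDeven e he
      have hev' := hW.hDeven e' he'
      rw [← hDD] at hev'
      exact hne (eq_of_fundamental_eq I hI hS heD he'D hev hev').symm
  · -- (EXC)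
    right
    refine ⟨ν₁, ν₂, hν₁, hν₂, gam B e + κ, fun w => ?_⟩
    have h := h3 w
    simp only [hQ, hq] at h
    rw [sys_u_eq] at h
    rw [qform_symmDiff, h]
    have e4 : ∀ g a p k : ZMod 2, a + (g + a + p + k) = p + (g + k) := by decide
    exact e4 _ _ _ _
  · -- NOR-shaped `u_e` on the chamber: contradicts rank four of `Q_{D e}` there
    exfalso
    set Bq := (polar (B.D e) (fun j => I.vars j 2) (fun j => I.vars j 3)).restrict W with hBqdef
    have hμ₁ : IsAffineFn (fun w : W => Bq w b + (q (x₀ + b) + q (x₀ + ↑(0 : W)))) :=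
      isAffineFn_of_linear (Bq.flip b) _
    have hμ₂ : IsAffineFn (fun w : W => Bq w a + (q (x₀ + a) + q (x₀ + ↑(0 : W)))) :=
      isAffineFn_of_linear (Bq.flip a) _
    exact not_rank_four_of_mul (Q := fun w : W => q (x₀ + w)) (quad_restrict hBq W x₀) hμ₁ hμ₂ (κ := 1) (fun w => hnor w) hrD


end Summit.PneNP.PneNP.Theorems.PstarGateFibre
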